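import Summits.RiemannHypothesis.RiemannHypothesis.Theorems.SemilocalDeletionSchurFloor
import Literature.NumberTheory.LFunctions.WeilSemilocalNegative
import HarnessLib

/-!
# The GENERAL deletion floor: any sub-family of atoms (small primes, prime powers, partial deletions)

`SemilocalDeletionSchurFloor.lean` proved the orbit-graph (Schur) floor for deleting primes `p` that are SINGLE visible atoms on the
window (`c < log p`).  The cell's other deletion data — the interaction hierarchy `I_{235}`, `I_{2357}`, … of DATA-CUT item (2), the
`{∞} → {∞,2} → {∞,2,3}` relay of SEMILOCAL-TABLE — deletes SMALL primes, whose powers `p, p², …` are several atoms on the window.  This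
file removes the single-atom restriction altogether: for ANY two finite sets `S' ⊆ S` and a window `C(c)` with `2c < log (N+1)`,

* §1 `Q_S(g) − Q_{S'}(g) = −Σ_{n ≤ N} (Λ_S(n) − Λ_{S'}(n)) n^{−1/2}·(k(log n) + k(−log n))` EXACTLY (`k = g ⋆ g̃`; the deleted atoms are
  the prime powers `n ≤ N` that are `S`-smooth but not `S'`-smooth, with weights `w_n = Λ(n)/√n ≥ 0`);
* §2 **the general Schur floor**: for every measurable weight `0 ≤ φ ≤ M`, `φ ≥ m > 0` on `[−c, c]`, with
  `Σ_{n ≤ N} w_n·(φ(x − log n) + φ(x + log n)) ≤ ρ·φ(x)` on `[−c, c]`:  `Re Q_{S'}(g) ≥ Re Q_S(g) − ρ‖g‖₂²`;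
* the bound is TWO-SIDED (`re_weilSemilocalQuadratic_le_of_schur_sub`): `|Re Q_{S'}(g) − Re Q_S(g)| ≤ ρ‖g‖₂²`, hence
  `|λ_min(S'; c; P) − λ_min(S; c; P)| ≤ ρ` — a deletion is a `ρ`-bounded move of every bottom (the data: it is always a DROP, to ≈ −ρ);
* §3 the indicator weight: `ρ = 2·Σ_{n ≤ N} w_n` always works at the Rayleigh level (twice the deleted visible mass; the factor 2 is
  needed exactly for the atoms with `log n ≤ c`, which can be reached from both sides); the energy form `λ_min(S'; c; P) ≥
  λ_min(S; c; P) − ρ` and the nonnegativity of the deleted weights are the tree's `SemilocalDeletionSliverSandwich`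
  (`semilocalGroundEnergy_ge_sub_two_mul_atomSum`, `deletedWeight_nonneg`; landed by gen13 after this file was written) and are not restated;
* §4 under RH (`S ⊇` every prime visible on the window): a bottom `λ_min(S'; c; P) < −ρ` for an admissible Schur constant `ρ`
  refutes RH — the falsifier now covers deletions of `2, 3, 5` at the cell's standard bandwidths.

Nothing here bears on the truth of RH.
-/

set_option linter.dupNamespace false

noncomputable section

open Complex Filter Set MeasureTheory
open scoped Real Topology ComplexConjugate

namespace Summit.RiemannHypothesis.RiemannHypothesis.Theorems.SemilocalDeletionGeneralFloor

open Literature.NumberTheory.LFunctions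
open Summit.RiemannHypothesis.RiemannHypothesis.Theorems.SemilocalDeletionCliff
open Summit.RiemannHypothesis.RiemannHypothesis.Theorems.SemilocalDeletionSchurFloor
open Summit.RiemannHypothesis.RiemannHypothesis.Theorems.HandoffSemilocalEnergy

variable {g : ℝ → ℂ} {φ : ℝ → ℝ} {m M c ρ : ℝ} {S S' : Finset ℕ} {N : ℕ}

/-! ## §1  Coefficients and the exact difference identity -/

/-- **The exact difference of two semi-local forms on a window.** For a test function `g ∈ C(c)` and `2c < log (N+1)`:
`Q_S(g) − Q_{S'}(g) = −Σ_{n ≤ N} (Λ_S(n) − Λ_{S'}(n)) n^{−1/2}·(k(log n) + k(−log n))`, `k = g ⋆ g̃` (any two finite sets). -/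
theorem weilSemilocalQuadratic_sub_eq_sum (hg : IsWeilTest g) (hsupp : tsupport g ⊆ Icc (-c) c)
    (hN : 2 * c < Real.log ((N : ℝ) + 1)) (S S' : Finset ℕ) :
    weilSemilocalQuadratic S g - weilSemilocalQuadratic S' g =
      -∑ n ∈ Finset.range (N + 1), (((weilSemilocalCoeff S n - weilSemilocalCoeff S' n : ℝ)) : ℂ) *
        (weilConv g (weilReflect g) (Real.log n) + weilConv g (weilReflect g) (-Real.log n)) := by
  set k := weilConv g (weilReflect g) with hkdef
  have hk : IsWeilTest k := hg.weilConv hg.weilReflect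
  have hks : tsupport k ⊆ Icc (-Real.log ((N : ℝ) + 1)) (Real.log ((N : ℝ) + 1)) :=
    (tsupport_weilConv_weilReflect_subset (a := c) hg.2 hsupp).trans (Icc_subset_Icc (by linarith) (by linarith))
  have hS := weilSemilocalPrimeTerm_eq_sum_of_tsupport_subset S hk.1.continuous N hks
  have hS' := weilSemilocalPrimeTerm_eq_sum_of_tsupport_subset S' hk.1.continuous N hks
  have hdiff : weilSemilocalPrimeTerm S k - weilSemilocalPrimeTerm S' k =
      ∑ n ∈ Finset.range (N + 1), (((weilSemilocalCoeff S n - weilSemilocalCoeff S' n : ℝ)) : ℂ) *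
        (k (Real.log n) + k (-Real.log n)) := by
    rw [hS, hS', ← Finset.sum_sub_distrib]
    refine Finset.sum_congr rfl fun n _ ↦ ?_
    push_cast
    ring
  unfold weilSemilocalQuadratic weilSemilocalFunctional
  rw [← hkdef]
  linear_combination (-1 : ℂ) * hdiff

/-! ## §2  The general Schur floor -/

/-- **THE GENERAL SCHUR FLOOR.** `S' ⊆ S` finite, `g ∈ C(c)` a Weil test function, `2c < log (N+1)`, `φ` a measurable weight with
`0 ≤ φ ≤ M` and `φ ≥ m > 0` on `[−c, c]` such that `Σ_{n ≤ N} (Λ_S(n) − Λ_{S'}(n)) n^{−1/2}·(φ(x − log n) + φ(x + log n)) ≤ ρ·φ(x)`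
for every `x ∈ [−c, c]`.  Then `Re Q_{S'}(g) ≥ Re Q_S(g) − ρ·‖g‖₂²`.  (No visibility condition on the deleted primes.) -/
theorem re_weilSemilocalQuadratic_ge_of_schur_sub (hsub : S' ⊆ S) (hg : IsWeilTest g) (hsupp : tsupport g ⊆ Icc (-c) c)
    (hN : 2 * c < Real.log ((N : ℝ) + 1)) (hφ : Measurable φ) (hφ0 : ∀ x, 0 ≤ φ x) (hφM : ∀ x, φ x ≤ M) (hm : 0 < m)
    (hφm : ∀ x ∈ Icc (-c) c, m ≤ φ x)
    (hρ : ∀ x ∈ Icc (-c) c, ∑ n ∈ Finset.range (N + 1),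
      (weilSemilocalCoeff S n - weilSemilocalCoeff S' n) * (φ (x - Real.log n) + φ (x + Real.log n)) ≤ ρ * φ x) :
    (weilSemilocalQuadratic S g).re - ρ * ∫ x : ℝ, ‖g x‖ ^ 2 ≤ (weilSemilocalQuadratic S' g).re := by
  have hφm' : ∀ x ∈ tsupport g, m ≤ φ x := fun x hx ↦ hφm x (hsupp hx)
  set F : ℕ → ℝ → ℝ := fun n x ↦ ‖g x‖ ^ 2 * ((φ (x - Real.log n) + φ (x + Real.log n)) / φ x) with hF
  have hFi : ∀ n, Integrable (F n) := fun n ↦ integrable_norm_sq_mul_schurWeight hg hφ hφ0 hφM hm hφm' _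
  -- Re of the identity: Re Q_{S'} = Re Q_S + Σ w_n Re K_n
  have hid := congrArg Complex.re (weilSemilocalQuadratic_sub_eq_sum hg hsupp hN S S')
  rw [Complex.sub_re, Complex.neg_re, Complex.re_sum] at hid
  -- termwise: w_n · Re K_n ≥ −w_n ∫ F_n
  have hterm : ∀ n ∈ Finset.range (N + 1), -((weilSemilocalCoeff S n - weilSemilocalCoeff S' n) * ∫ x : ℝ, F n x) ≤
      ((((weilSemilocalCoeff S n - weilSemilocalCoeff S' n : ℝ)) : ℂ) *
        (weilConv g (weilReflect g) (Real.log n) + weilConv g (weilReflect g) (-Real.log n))).re := by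
    intro n _
    have hw : 0 ≤ weilSemilocalCoeff S n - weilSemilocalCoeff S' n := (by
      -- the deleted weight is nonnegative (`SemilocalDeletionSliverSandwich.deletedWeight_nonneg`, inlined: that module has no hub olean yet)
      by_cases h' : n.primeFactors ⊆ S'
      · have hS2 : n.primeFactors ⊆ S := h'.trans hsub
        unfold weilSemilocalCoeff; rw [if_pos h', if_pos hS2, sub_self]
      · have h0 : weilSemilocalCoeff S' n = 0 := by unfold weilSemilocalCoeff; rw [if_neg h']
        rw [h0, sub_zero]; exact weilSemilocalCoeff_nonneg S n)
    have hK := norm_weilConv_weilReflect_add_neg_le_schur hg hφ hφ0 hφM hm hφm' (Real.log n)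
    have hre := abs_re_le_norm
      (weilConv g (weilReflect g) (Real.log n) + weilConv g (weilReflect g) (-Real.log n))
    rw [Complex.re_ofReal_mul]
    have := (abs_le.1 (hre.trans hK)).1
    nlinarith
  have hsum := Finset.sum_le_sum hterm
  -- Σ_n w_n ∫ F_n = ∫ Σ_n w_n F_n ≤ ∫ ρ |g|²
  have hswap : ∑ n ∈ Finset.range (N + 1), (weilSemilocalCoeff S n - weilSemilocalCoeff S' n) * ∫ x : ℝ, F n x =
      ∫ x : ℝ, ∑ n ∈ Finset.range (N + 1), (weilSemilocalCoeff S n - weilSemilocalCoeff S' n) * F n x := by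
    rw [integral_finsetSum _ fun n _ ↦ (hFi n).const_mul _]
    simp only [integral_const_mul]
  have hpt : ∀ x : ℝ, ∑ n ∈ Finset.range (N + 1), (weilSemilocalCoeff S n - weilSemilocalCoeff S' n) * F n x ≤
      ρ * ‖g x‖ ^ 2 := by
    intro x
    by_cases hx : g x = 0
    · simp [hF, hx]
    · have hxW : x ∈ Icc (-c) c := hsupp (subset_tsupport _ (Function.mem_support.2 hx))
      have hφx : 0 < φ x := hm.trans_le (hφm x hxW)
      have e : ∑ n ∈ Finset.range (N + 1), (weilSemilocalCoeff S n - weilSemilocalCoeff S' n) * F n x =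
          ‖g x‖ ^ 2 * ((∑ n ∈ Finset.range (N + 1), (weilSemilocalCoeff S n - weilSemilocalCoeff S' n) *
            (φ (x - Real.log n) + φ (x + Real.log n))) / φ x) := by
        rw [Finset.sum_div, Finset.mul_sum]
        refine Finset.sum_congr rfl fun n _ ↦ ?_
        simp only [hF]
        ring
      rw [e, mul_comm ρ]
      exact mul_le_mul_of_nonneg_left ((div_le_iff₀ hφx).2 (hρ x hxW)) (sq_nonneg _)
  have hint : ∫ x : ℝ, ∑ n ∈ Finset.range (N + 1), (weilSemilocalCoeff S n - weilSemilocalCoeff S' n) * F n x ≤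
      ∫ x : ℝ, ρ * ‖g x‖ ^ 2 :=
    integral_mono (integrable_finsetSum _ fun n _ ↦ (hFi n).const_mul _) (hg.integrable_norm_sq.const_mul ρ) hpt
  rw [integral_const_mul] at hint
  have hneg : -(∑ n ∈ Finset.range (N + 1), (weilSemilocalCoeff S n - weilSemilocalCoeff S' n) * ∫ x : ℝ, F n x) ≤
      ∑ n ∈ Finset.range (N + 1), ((((weilSemilocalCoeff S n - weilSemilocalCoeff S' n : ℝ)) : ℂ) *
        (weilConv g (weilReflect g) (Real.log n) + weilConv g (weilReflect g) (-Real.log n))).re := by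
    rw [← Finset.sum_neg_distrib]; exact hsum
  linarith

/-- **The Schur bound is two-sided**: under the same hypotheses `Re Q_{S'}(g) ≤ Re Q_S(g) + ρ·‖g‖₂²` — deleting the atoms moves the
form by at most `ρ‖g‖₂²` in EITHER direction (the weighted sliver bound controls `|k(log n) + k(−log n)|`). -/
theorem re_weilSemilocalQuadratic_le_of_schur_sub (hsub : S' ⊆ S) (hg : IsWeilTest g) (hsupp : tsupport g ⊆ Icc (-c) c)
    (hN : 2 * c < Real.log ((N : ℝ) + 1)) (hφ : Measurable φ) (hφ0 : ∀ x, 0 ≤ φ x) (hφM : ∀ x, φ x ≤ M) (hm : 0 < m)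
    (hφm : ∀ x ∈ Icc (-c) c, m ≤ φ x)
    (hρ : ∀ x ∈ Icc (-c) c, ∑ n ∈ Finset.range (N + 1),
      (weilSemilocalCoeff S n - weilSemilocalCoeff S' n) * (φ (x - Real.log n) + φ (x + Real.log n)) ≤ ρ * φ x) :
    (weilSemilocalQuadratic S' g).re ≤ (weilSemilocalQuadratic S g).re + ρ * ∫ x : ℝ, ‖g x‖ ^ 2 := by
  have hφm' : ∀ x ∈ tsupport g, m ≤ φ x := fun x hx ↦ hφm x (hsupp hx)
  set F : ℕ → ℝ → ℝ := fun n x ↦ ‖g x‖ ^ 2 * ((φ (x - Real.log n) + φ (x + Real.log n)) / φ x) with hF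
  have hFi : ∀ n, Integrable (F n) := fun n ↦ integrable_norm_sq_mul_schurWeight hg hφ hφ0 hφM hm hφm' _
  -- Re of the identity: Re Q_{S'} = Re Q_S + Σ w_n Re K_n
  have hid := congrArg Complex.re (weilSemilocalQuadratic_sub_eq_sum hg hsupp hN S S')
  rw [Complex.sub_re, Complex.neg_re, Complex.re_sum] at hid
  -- termwise: w_n · Re K_n ≤ w_n ∫ F_n
  have hterm : ∀ n ∈ Finset.range (N + 1),
      ((((weilSemilocalCoeff S n - weilSemilocalCoeff S' n : ℝ)) : ℂ) *
        (weilConv g (weilReflect g) (Real.log n) + weilConv g (weilReflect g) (-Real.log n))).re ≤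
      (weilSemilocalCoeff S n - weilSemilocalCoeff S' n) * ∫ x : ℝ, F n x := by
    intro n _
    have hw : 0 ≤ weilSemilocalCoeff S n - weilSemilocalCoeff S' n := (by
      -- the deleted weight is nonnegative (`SemilocalDeletionSliverSandwich.deletedWeight_nonneg`, inlined: that module has no hub olean yet)
      by_cases h' : n.primeFactors ⊆ S'
      · have hS2 : n.primeFactors ⊆ S := h'.trans hsub
        unfold weilSemilocalCoeff; rw [if_pos h', if_pos hS2, sub_self]
      · have h0 : weilSemilocalCoeff S' n = 0 := by unfold weilSemilocalCoeff; rw [if_neg h']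
        rw [h0, sub_zero]; exact weilSemilocalCoeff_nonneg S n)
    have hK := norm_weilConv_weilReflect_add_neg_le_schur hg hφ hφ0 hφM hm hφm' (Real.log n)
    have hre := abs_re_le_norm
      (weilConv g (weilReflect g) (Real.log n) + weilConv g (weilReflect g) (-Real.log n))
    rw [Complex.re_ofReal_mul]
    have := (abs_le.1 (hre.trans hK)).2
    nlinarith
  have hsum := Finset.sum_le_sum hterm
  -- Σ_n w_n ∫ F_n = ∫ Σ_n w_n F_n ≤ ∫ ρ |g|²
  have hswap : ∑ n ∈ Finset.range (N + 1), (weilSemilocalCoeff S n - weilSemilocalCoeff S' n) * ∫ x : ℝ, F n x =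
      ∫ x : ℝ, ∑ n ∈ Finset.range (N + 1), (weilSemilocalCoeff S n - weilSemilocalCoeff S' n) * F n x := by
    rw [integral_finsetSum _ fun n _ ↦ (hFi n).const_mul _]
    simp only [integral_const_mul]
  have hpt : ∀ x : ℝ, ∑ n ∈ Finset.range (N + 1), (weilSemilocalCoeff S n - weilSemilocalCoeff S' n) * F n x ≤
      ρ * ‖g x‖ ^ 2 := by
    intro x
    by_cases hx : g x = 0
    · simp [hF, hx]
    · have hxW : x ∈ Icc (-c) c := hsupp (subset_tsupport _ (Function.mem_support.2 hx))
      have hφx : 0 < φ x := hm.trans_le (hφm x hxW)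
      have e : ∑ n ∈ Finset.range (N + 1), (weilSemilocalCoeff S n - weilSemilocalCoeff S' n) * F n x =
          ‖g x‖ ^ 2 * ((∑ n ∈ Finset.range (N + 1), (weilSemilocalCoeff S n - weilSemilocalCoeff S' n) *
            (φ (x - Real.log n) + φ (x + Real.log n))) / φ x) := by
        rw [Finset.sum_div, Finset.mul_sum]
        refine Finset.sum_congr rfl fun n _ ↦ ?_
        simp only [hF]
        ring
      rw [e, mul_comm ρ]
      exact mul_le_mul_of_nonneg_left ((div_le_iff₀ hφx).2 (hρ x hxW)) (sq_nonneg _)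
  have hint : ∫ x : ℝ, ∑ n ∈ Finset.range (N + 1), (weilSemilocalCoeff S n - weilSemilocalCoeff S' n) * F n x ≤
      ∫ x : ℝ, ρ * ‖g x‖ ^ 2 :=
    integral_mono (integrable_finsetSum _ fun n _ ↦ (hFi n).const_mul _) (hg.integrable_norm_sq.const_mul ρ) hpt
  rw [integral_const_mul] at hint
  rw [hswap] at hsum
  linarith

/-! ## §3  The indicator weight: twice the deleted visible mass -/

/-- **Floor by twice the deleted mass.** For `S' ⊆ S`, `g ∈ C(c)`, `2c < log (N+1)`:
`Re Q_{S'}(g) ≥ Re Q_S(g) − 2·(Σ_{n ≤ N} (Λ_S(n) − Λ_{S'}(n)) n^{−1/2})·‖g‖₂²` (Schur weight `𝟙_{[−c,c]}`; each atom is reached from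
at most two sides). -/
theorem re_weilSemilocalQuadratic_ge_sub_two_mul_sum (hsub : S' ⊆ S) (hg : IsWeilTest g) (hsupp : tsupport g ⊆ Icc (-c) c)
    (hN : 2 * c < Real.log ((N : ℝ) + 1)) :
    (weilSemilocalQuadratic S g).re -
        2 * (∑ n ∈ Finset.range (N + 1), (weilSemilocalCoeff S n - weilSemilocalCoeff S' n)) * ∫ x : ℝ, ‖g x‖ ^ 2 ≤
      (weilSemilocalQuadratic S' g).re := by
  have h := re_weilSemilocalQuadratic_ge_of_schur_sub (ρ := 2 * ∑ n ∈ Finset.range (N + 1),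
      (weilSemilocalCoeff S n - weilSemilocalCoeff S' n)) hsub hg hsupp hN (φ := (Icc (-c) c).indicator 1)
    (M := 1) (m := 1) (measurable_one.indicator measurableSet_Icc)
    (fun x ↦ Set.indicator_nonneg (fun _ _ ↦ zero_le_one) x)
    (fun x ↦ Set.indicator_apply_le' (fun _ ↦ le_rfl) fun _ ↦ zero_le_one) zero_lt_one
    (fun x hx ↦ by rw [Set.indicator_of_mem hx]; simp) fun x hx ↦ ?_
  · exact h
  rw [Set.indicator_of_mem hx, Pi.one_apply, mul_one, Finset.mul_sum]
  refine Finset.sum_le_sum fun n _ ↦ ?_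
  have hw : 0 ≤ weilSemilocalCoeff S n - weilSemilocalCoeff S' n := (by
      -- the deleted weight is nonnegative (`SemilocalDeletionSliverSandwich.deletedWeight_nonneg`, inlined: that module has no hub olean yet)
      by_cases h' : n.primeFactors ⊆ S'
      · have hS2 : n.primeFactors ⊆ S := h'.trans hsub
        unfold weilSemilocalCoeff; rw [if_pos h', if_pos hS2, sub_self]
      · have h0 : weilSemilocalCoeff S' n = 0 := by unfold weilSemilocalCoeff; rw [if_neg h']
        rw [h0, sub_zero]; exact weilSemilocalCoeff_nonneg S n)
  have h1 : (Icc (-c) c).indicator (1 : ℝ → ℝ) (x - Real.log n) ≤ 1 :=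
    Set.indicator_apply_le' (fun _ ↦ le_rfl) fun _ ↦ zero_le_one
  have h2 : (Icc (-c) c).indicator (1 : ℝ → ℝ) (x + Real.log n) ≤ 1 :=
    Set.indicator_apply_le' (fun _ ↦ le_rfl) fun _ ↦ zero_le_one
  nlinarith

variable {P : (ℝ → ℂ) → Prop}

/-- **General Schur floor for the bottoms**: under the hypotheses of `re_weilSemilocalQuadratic_ge_of_schur_sub` (with `ρ ≥ 0`),
`λ_min(S'; c; P) ≥ λ_min(S; c; P) − ρ` for every constraint `P`. -/
theorem semilocalGroundEnergy_ge_of_schur_sub (hsub : S' ⊆ S) (hN : 2 * c < Real.log ((N : ℝ) + 1)) (hφ : Measurable φ)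
    (hφ0 : ∀ x, 0 ≤ φ x) (hφM : ∀ x, φ x ≤ M) (hm : 0 < m) (hφm : ∀ x ∈ Icc (-c) c, m ≤ φ x) (hρ0 : 0 ≤ ρ)
    (hρ : ∀ x ∈ Icc (-c) c, ∑ n ∈ Finset.range (N + 1),
      (weilSemilocalCoeff S n - weilSemilocalCoeff S' n) * (φ (x - Real.log n) + φ (x + Real.log n)) ≤ ρ * φ x) :
    semilocalGroundEnergy S P c - ρ ≤ semilocalGroundEnergy S' P c := by
  rcases (semilocalSphereValues S' P c).eq_empty_or_nonempty with he | hne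
  · have he' : semilocalSphereValues S P c = ∅ := by
      rcases (semilocalSphereValues S P c).eq_empty_or_nonempty with h0 | h0
      · exact h0
      · have := (semilocalSphereValues_nonempty_iff S P c).1 h0
        rw [← semilocalSphereValues_nonempty_iff S' P c, he] at this
        exact absurd this Set.not_nonempty_empty
    rw [semilocalGroundEnergy, semilocalGroundEnergy, he, he', Real.sInf_empty]
    linarith
  · refine le_semilocalGroundEnergy hne fun g hg hs hPg hn ↦ ?_
    have h1 := re_weilSemilocalQuadratic_ge_of_schur_sub hsub hg hs hN hφ hφ0 hφM hm hφm hρ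
    have h2 := semilocalGroundEnergy_le_re (S := S) hg hs hPg hn
    rw [hn, mul_one] at h1
    linarith

/-- **Two-sided energy form**: under the same hypotheses also `λ_min(S'; c; P) ≤ λ_min(S; c; P) + ρ`, so
`|λ_min(S'; c; P) − λ_min(S; c; P)| ≤ ρ`: a deletion is a `ρ`-bounded move of every constrained bottom. -/
theorem semilocalGroundEnergy_le_of_schur_sub (hsub : S' ⊆ S) (hN : 2 * c < Real.log ((N : ℝ) + 1)) (hφ : Measurable φ)
    (hφ0 : ∀ x, 0 ≤ φ x) (hφM : ∀ x, φ x ≤ M) (hm : 0 < m) (hφm : ∀ x ∈ Icc (-c) c, m ≤ φ x) (hρ0 : 0 ≤ ρ)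
    (hρ : ∀ x ∈ Icc (-c) c, ∑ n ∈ Finset.range (N + 1),
      (weilSemilocalCoeff S n - weilSemilocalCoeff S' n) * (φ (x - Real.log n) + φ (x + Real.log n)) ≤ ρ * φ x) :
    semilocalGroundEnergy S' P c ≤ semilocalGroundEnergy S P c + ρ := by
  rcases (semilocalSphereValues S P c).eq_empty_or_nonempty with he | hne
  · have he' : semilocalSphereValues S' P c = ∅ := by
      rcases (semilocalSphereValues S' P c).eq_empty_or_nonempty with h0 | h0
      · exact h0
      · have := (semilocalSphereValues_nonempty_iff S' P c).1 h0
        rw [← semilocalSphereValues_nonempty_iff S P c, he] at this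
        exact absurd this Set.not_nonempty_empty
    rw [semilocalGroundEnergy, semilocalGroundEnergy, he, he', Real.sInf_empty]
    linarith
  · have key : semilocalGroundEnergy S' P c - ρ ≤ semilocalGroundEnergy S P c := by
      refine le_semilocalGroundEnergy hne fun g hg hs hPg hn ↦ ?_
      have h1 := re_weilSemilocalQuadratic_le_of_schur_sub hsub hg hs hN hφ hφ0 hφM hm hφm hρ
      have h2 := semilocalGroundEnergy_le_re (S := S') hg hs hPg hn
      rw [hn, mul_one] at h1
      linarith
    linarith

/-! ## §4  Under RH: the general falsifier -/

/-- **FALSIFIER (general deletion).** `S ⊇ {prime factors of prime powers ≤ N}`, `S' ⊆ S`, `0 < c` with `2c < log (N+1)`, a Schur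
weight as in §2 with constant `ρ`, a scaling-stable constraint `P`: a bottom `λ_min(S'; c; P) < −ρ` refutes RH.  With the indicator
weight: `λ_min(S'; c; P) < −2·Σ_{n ≤ N} (Λ_S − Λ_{S'})(n) n^{−1/2}` refutes RH — e.g. the cell's deletions of `2, 3, 5` at its standard
bandwidths. -/
theorem not_riemannHypothesis_of_semilocalGroundEnergy_lt_of_schur_sub (hS : ∀ n ≤ N, IsPrimePow n → n.primeFactors ⊆ S)
    (hsub : S' ⊆ S) (hc : 0 < c) (hN : 2 * c < Real.log ((N : ℝ) + 1)) (hφ : Measurable φ) (hφ0 : ∀ x, 0 ≤ φ x)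
    (hφM : ∀ x, φ x ≤ M) (hm : 0 < m) (hφm : ∀ x ∈ Icc (-c) c, m ≤ φ x) (hρ0 : 0 ≤ ρ)
    (hρ : ∀ x ∈ Icc (-c) c, ∑ n ∈ Finset.range (N + 1),
      (weilSemilocalCoeff S n - weilSemilocalCoeff S' n) * (φ (x - Real.log n) + φ (x + Real.log n)) ≤ ρ * φ x)
    (hP : ∀ (a : ℝ) (g : ℝ → ℂ), 0 < a → P g → P fun t ↦ (a : ℂ) * g t)
    (hlt : semilocalGroundEnergy S' P c < -ρ) : ¬ Summit.RiemannHypothesis := by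
  intro hRH
  have hW : WeilPositivityOn c := (riemannHypothesis_iff_forall_weilPositivityOn.1 (Summit.RiemannHypothesis_iff.1 hRH)) c hc
  have hposS : WeilSemilocalPositivityOn S c :=
    (MotivicDoor.Semilocal.weilSemilocalPositivityOn_iff_weilPositivityOn_of_le hS (by linarith)).2 hW
  have h0 : 0 ≤ semilocalGroundEnergy S P c := (semilocalGroundEnergy_nonneg_iff hP).2 fun g hg hs _ ↦ hposS g hg hs
  have h1 := semilocalGroundEnergy_ge_of_schur_sub (P := P) hsub hN hφ hφ0 hφM hm hφm hρ0 hρ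
  linarith

end Summit.RiemannHypothesis.RiemannHypothesis.Theorems.SemilocalDeletionGeneralFloor

end
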